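import Literature.Probability.LatticeModels.RandomClusterConditionalDomination
import Literature.Probability.LatticeModels.RandomClusterSuccessiveConditioning
import HarnessLib

/-!
# Domain Markov property of the random-cluster measure across a CLOSED vertex cut (proved)

Topic `Literature/Probability/LatticeModels` (trunk `StatMech`, family `crit-ising`). The simplest
instance of the domain Markov property of the finite-graph random-cluster measure
`φ^B_{G,p,q} = rcMeasure G p q B` (`RandomCluster.lean`), for an ARBITRARY wired set `B`
(Grimmett 2006, Thm. (3.1)(a) and Lemma (4.13)). Let `S` be a vertex set, `T` the set of edges of
`G` touching `S`, and `M = E(G) ∖ T` the remaining edges (all of whose endpoints lie off `S`). If the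
configuration `ζ` on `T` has all its OPEN edges inside `S` — no open edge crosses the vertex cut
between `S` and `Sᶜ`, "the cut is closed" —, then an open path between a vertex of `S` and a vertex
of `Sᶜ` can only use the wiring `K_B`, so for every configuration `η` on `M` the cluster count
splits,

  `k^B(ζ ∪ η) + k^{B ∖ S}(∅) = k^B(ζ) + k^{B ∖ S}(η)`

(`clusterCount_union_add_eq_of_closed_cut`; the counts on the right are those of the spanning
graph `⟨M⟩` on all of `V`, whose isolated vertices of `S` only shift the count by a constant).
Hence the weights factorise and, conditionally on an event `F` determined by the configuration on
`T` on which the cut is closed, the configuration on `M` has the law of the random-cluster measure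
of `⟨M⟩` with wired set `B ∖ S`, whatever `B` is on the `S` side:

  `φ^B_{G,p,q}(F ∩ C) = φ^B_{G,p,q}(F) · φ^{B ∖ S}_{⟨M⟩,p,q}(C)`

for every event `C` determined by the configuration on `M`
(`rcMeasure_real_inter_eq_mul_of_closed_cut`; `0 ≤ p ≤ 1`, `q > 0`). This generalises
`rcMeasure_real_inter_cylinder_empty_eq_mul_fromEdgeSet` (`RandomClusterConditionalDomination.lean`,
the case "all edges off the region closed") and is the Markov input of the boundary-condition
toolkit with an inner wired blob, used when an exploration from outside has empty rim.
Everything is proved; no definitions, no named facts.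

## References

* G. Grimmett, *The Random-Cluster Model*, Springer (2006): Thm. (3.1)(a), eq. (3.2); §4.2,
  eqs. (4.11)–(4.13), Lemma (4.13) (nesting / domain Markov property).
* H. Duminil-Copin, S. Smirnov, *Conformal invariance of lattice models*, Clay Math. Proc. 15
  (2012) 213–276: §3.2 (domain Markov property).
-/

noncomputable section

open MeasureTheory Finset SimpleGraph
open Literature.Probability.Percolation (BondConfig)

namespace Literature.Probability.LatticeModels

/-! ### Reachability across a closed cut -/

section Reach

variable {V : Type*}

/-- **Across a closed cut, an `S`-excursion is a jump of the wiring off `S`.** Let the edges of `a`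
have no endpoint in `S` and the edges of `ξ` have all their endpoints in `S`. Then two vertices off
`S` joined in `⟨a⟩ ∨ ⟨ξ⟩ ∨ K_B` are joined in `⟨a⟩ ∨ K_{B ∖ S}`: a walk can enter and leave `S` only by
jumps of the wiring `K_B`, whose endpoints off `S` lie in `B ∖ S`.
[cite: Grimmett2006, Thm. (3.1)(a) and Lemma (4.13)] -/
theorem reachable_sup_wired_sdiff_of_closed_cut {a ξ : Set (Sym2 V)} {B S : Set V}
    (ha : ∀ e ∈ a, ∀ x ∈ e, x ∉ S) (hξ : ∀ e ∈ ξ, ∀ x ∈ e, x ∈ S)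
    {u v : V} (hu : u ∉ S) (hv : v ∉ S)
    (h : (fromEdgeSet a ⊔ (fromEdgeSet ξ ⊔ wired B)).Reachable u v) :
    (fromEdgeSet a ⊔ wired (B \ S)).Reachable u v := by
  obtain ⟨p⟩ := h
  have hKW : ∀ {s t : V}, s ∈ B \ S → t ∈ B \ S → (fromEdgeSet a ⊔ wired (B \ S)).Reachable s t := by
    intro s t hs ht
    by_cases hst : s = t
    · subst hst; exact Reachable.refl _
    · exact Adj.reachable (Or.inr (by rw [wired_adj]; exact ⟨hst, hs, ht⟩))
  -- invariant along a walk towards a vertex off `S`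
  suffices H : ∀ {x y : V} (_ : (fromEdgeSet a ⊔ (fromEdgeSet ξ ⊔ wired B)).Walk x y), y ∉ S →
      (x ∉ S → (fromEdgeSet a ⊔ wired (B \ S)).Reachable x y) ∧
      (x ∈ S → ∃ w ∈ B \ S, (fromEdgeSet a ⊔ wired (B \ S)).Reachable w y) from
    (H p hv).1 hu
  intro x y q
  induction q with
  | nil => exact fun hy => ⟨fun _ => Reachable.refl _, fun hx => absurd hx hy⟩
  | @cons x x₁ z hxx₁ q ih =>
    intro hz
    have ih := ih hz
    rw [sup_adj] at hxx₁
    rcases hxx₁ with hA | hΞ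
    · -- an edge of `a`: both endpoints off `S`
      have hmem := ((fromEdgeSet_adj _).1 hA).1
      have hx : x ∉ S := ha _ hmem x (Sym2.mem_mk_left x x₁)
      have hx₁ : x₁ ∉ S := ha _ hmem x₁ (Sym2.mem_mk_right x x₁)
      refine ⟨fun _ => ?_, fun hx' => absurd hx' hx⟩
      have h1 : (fromEdgeSet a ⊔ wired (B \ S)).Adj x x₁ := Or.inl hA
      exact h1.reachable.trans (ih.1 hx₁)
    · rw [sup_adj] at hΞ
      rcases hΞ with hΞ | hΞ
      · -- an edge of `ξ`: both endpoints in `S`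
        have hmem := ((fromEdgeSet_adj _).1 hΞ).1
        have hx : x ∈ S := hξ _ hmem x (Sym2.mem_mk_left x x₁)
        have hx₁ : x₁ ∈ S := hξ _ hmem x₁ (Sym2.mem_mk_right x x₁)
        exact ⟨fun hx' => absurd hx hx', fun _ => ih.2 hx₁⟩
      · -- a jump of the wiring `K_B`
        rw [wired_adj] at hΞ
        obtain ⟨-, hxB, hx₁B⟩ := hΞ
        by_cases hx₁ : x₁ ∈ S
        · obtain ⟨w, hw, hwz⟩ := ih.2 hx₁
          exact ⟨fun hx => (hKW ⟨hxB, hx⟩ hw).trans hwz, fun _ => ⟨w, hw, hwz⟩⟩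
        · have ih1 := ih.1 hx₁
          exact ⟨fun hx => (hKW ⟨hxB, hx⟩ ⟨hx₁B, hx₁⟩).trans ih1, fun _ => ⟨x₁, ⟨hx₁B, hx₁⟩, ih1⟩⟩

/-- **A jump of the wiring off `S` is a jump of `K_B`.** `⟨a⟩ ∨ K_{B ∖ S}`-reachability implies
`⟨a⟩ ∨ ⟨ξ⟩ ∨ K_B`-reachability (monotonicity). [cite: Grimmett2006, Thm. (3.1)(a) and Lemma (4.13)] -/
theorem reachable_sup_sup_wired_of_reachable_sup_wired_sdiff {a ξ : Set (Sym2 V)} {B S : Set V}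
    {u v : V} (h : (fromEdgeSet a ⊔ wired (B \ S)).Reachable u v) :
    (fromEdgeSet a ⊔ (fromEdgeSet ξ ⊔ wired B)).Reachable u v :=
  h.mono (sup_le_sup_left ((wired_mono Set.sdiff_subset).trans le_sup_right) _)

/-- The two reachability relations agree off `S` when the cut is closed.
[cite: Grimmett2006, Thm. (3.1)(a) and Lemma (4.13)] -/
theorem reachable_sup_sup_wired_iff_of_closed_cut {a ξ : Set (Sym2 V)} {B S : Set V}
    (ha : ∀ e ∈ a, ∀ x ∈ e, x ∉ S) (hξ : ∀ e ∈ ξ, ∀ x ∈ e, x ∈ S)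
    {u v : V} (hu : u ∉ S) (hv : v ∉ S) :
    (fromEdgeSet a ⊔ (fromEdgeSet ξ ⊔ wired B)).Reachable u v ↔
      (fromEdgeSet a ⊔ wired (B \ S)).Reachable u v :=
  ⟨reachable_sup_wired_sdiff_of_closed_cut ha hξ hu hv,
    reachable_sup_sup_wired_of_reachable_sup_wired_sdiff⟩

end Reach

/-! ### The cluster-count identity -/

section ClusterCount

variable {V : Type*} [Finite V]

/-- **Cluster counts across a closed cut.** For edges `a` with no endpoint in `S` and edges `ξ`
with all endpoints in `S`: `k^B(a ∪ ξ) + k^{B ∖ S}(∅) = k^B(ξ) + k^{B ∖ S}(a)`, i.e.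
`k^B(a ∪ ξ) - k^{B ∖ S}(a)` does not depend on `a` (induction on `a`: a new edge off `S` merges two
clusters on the left iff it does on the right, `reachable_sup_sup_wired_iff_of_closed_cut`).
[cite: Grimmett2006, Thm. (3.1)(a) and Lemma (4.13)] -/
theorem clusterCount_union_add_eq_of_closed_cut (a : Finset (Sym2 V)) (ξ : Set (Sym2 V))
    {B S : Set V} (ha : ∀ e ∈ a, ∀ x ∈ e, x ∉ S) (hξ : ∀ e ∈ ξ, ∀ x ∈ e, x ∈ S) :
    clusterCount ((↑a : Set (Sym2 V)) ∪ ξ) B + clusterCount (∅ : BondConfig V) (B \ S) =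
      clusterCount ξ B + clusterCount (↑a : BondConfig V) (B \ S) := by
  classical
  induction a using Finset.induction_on with
  | empty => simp [clusterCount, Percolation.openGraph]
  | insert e a hea ih =>
    have ha' : ∀ e ∈ a, ∀ x ∈ e, x ∉ S := fun e' he' => ha e' (Finset.mem_insert_of_mem he')
    have ih' := ih ha'
    induction e using Sym2.ind with
    | h u v =>
      have hu : u ∉ S := ha _ (Finset.mem_insert_self _ _) u (Sym2.mem_mk_left u v)
      have hv : v ∉ S := ha _ (Finset.mem_insert_self _ _) v (Sym2.mem_mk_right u v)
      -- the graphs after inserting the edge `uv`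
      have h1 : fromEdgeSet ((↑(insert s(u, v) a) : Set (Sym2 V)) ∪ ξ) ⊔ wired B =
          (fromEdgeSet (↑a : Set (Sym2 V)) ⊔ (fromEdgeSet ξ ⊔ wired B)) ⊔ edge u v := by
        rw [Finset.coe_insert, Set.insert_union, Set.insert_eq, fromEdgeSet_union, fromEdgeSet_union]
        have he : fromEdgeSet ({s(u, v)} : Set (Sym2 V)) = edge u v := rfl
        rw [he]
        ac_rfl
      have h0 : fromEdgeSet ((↑a : Set (Sym2 V)) ∪ ξ) ⊔ wired B =
          fromEdgeSet (↑a : Set (Sym2 V)) ⊔ (fromEdgeSet ξ ⊔ wired B) := by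
        rw [fromEdgeSet_union, sup_assoc]
      have h2 : fromEdgeSet (↑(insert s(u, v) a) : Set (Sym2 V)) ⊔ wired (B \ S) =
          (fromEdgeSet (↑a : Set (Sym2 V)) ⊔ wired (B \ S)) ⊔ edge u v := by
        rw [Finset.coe_insert, Set.insert_eq, fromEdgeSet_union, sup_comm (fromEdgeSet {s(u, v)}),
          sup_right_comm]
        rfl
      unfold clusterCount Percolation.openGraph at ih' ⊢
      rw [h1, h2]
      rw [h0] at ih'
      set K₁ : SimpleGraph V := fromEdgeSet (↑a : Set (Sym2 V)) ⊔ (fromEdgeSet ξ ⊔ wired B) with hK₁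
      set K₂ : SimpleGraph V := fromEdgeSet (↑a : Set (Sym2 V)) ⊔ wired (B \ S) with hK₂
      have hiff : K₁.Reachable u v ↔ K₂.Reachable u v :=
        reachable_sup_sup_wired_iff_of_closed_cut (fun e' he' => ha' e' (Finset.mem_coe.1 he')) hξ hu hv
      by_cases huv : K₁.Reachable u v
      · rw [card_connectedComponent_sup_edge_of_reachable K₁ huv,
          card_connectedComponent_sup_edge_of_reachable K₂ (hiff.1 huv)]
        exact ih'
      · have huv' : ¬K₂.Reachable u v := fun h => huv (hiff.2 h)
        have l1 := card_connectedComponent_sup_edge_lt K₁ huv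
        have l1' := card_connectedComponent_le_sup_edge_add_one K₁ u v
        have l2 := card_connectedComponent_sup_edge_lt K₂ huv'
        have l2' := card_connectedComponent_le_sup_edge_add_one K₂ u v
        omega

end ClusterCount

/-! ### Weights and the exact conditional law on a cylinder -/

section Finite

variable {V : Type*} [Fintype V] [DecidableEq V] (G : SimpleGraph V) [DecidableRel G.Adj]

/-- **Weights factorise across a closed cut.** For a region `U ⊆ E(G)` none of whose edges has an
endpoint in `S`, a configuration `ζ₀ ⊆ E(G) ∖ U` all of whose edges lie inside `S`, and `η ⊆ U`:
`w^B_G(η ∪ ζ₀) · q^{k^{B∖S}(∅)} = p^{|ζ₀|} (1 - p)^{|E(G) ∖ U| - |ζ₀|} q^{k^B(ζ₀)} · w^{B∖S}_{⟨U⟩}(η)`.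
[cite: Grimmett2006, Thm. (3.1)(a) and Lemma (4.13)] -/
theorem rcWeight_union_mul_eq_mul_rcWeight_fromEdgeSet_of_closed_cut (p q : ℝ) {B S : Set V}
    {U ζ₀ η : Finset (Sym2 V)} (hU : U ⊆ G.edgeFinset) (hζ₀ : ζ₀ ⊆ G.edgeFinset \ U) (hη : η ⊆ U)
    (hUS : ∀ e ∈ U, ∀ x ∈ e, x ∉ S) (hζS : ∀ e ∈ ζ₀, ∀ x ∈ e, x ∈ S) :
    rcWeight G p q B (η ∪ ζ₀) * q ^ clusterCount (∅ : BondConfig V) (B \ S) =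
      p ^ #ζ₀ * (1 - p) ^ (#(G.edgeFinset \ U) - #ζ₀) *
        q ^ clusterCount (↑ζ₀ : BondConfig V) B *
        rcWeight (fromEdgeSet (U : Set (Sym2 V))) p q (B \ S) η := by
  have hEU : ∀ i : Fintype (fromEdgeSet (U : Set (Sym2 V))).edgeSet,
      @SimpleGraph.edgeFinset V (fromEdgeSet (U : Set (Sym2 V))) i = U := fun i ↦
    @edgeFinset_fromEdgeSet_of_subset V _ G _ U hU i
  have hζ₀U : Disjoint ζ₀ U := Finset.disjoint_of_subset_left hζ₀ sdiff_disjoint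
  have hηζ : Disjoint η ζ₀ := Finset.disjoint_of_subset_left hη hζ₀U.symm
  -- cardinalities
  have hcard₁ : #(η ∪ ζ₀) = #η + #ζ₀ := card_union_of_disjoint hηζ
  have hsplit : G.edgeFinset \ (η ∪ ζ₀) = (U \ η) ∪ ((G.edgeFinset \ U) \ ζ₀) := by
    ext e
    simp only [mem_sdiff, mem_union, not_or]
    constructor
    · rintro ⟨heE, heη, heζ⟩
      by_cases heU : e ∈ U
      · exact Or.inl ⟨heU, heη⟩
      · exact Or.inr ⟨⟨heE, heU⟩, heζ⟩
    · rintro (⟨heU, heη⟩ | ⟨⟨heE, heU⟩, heζ⟩)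
      · exact ⟨hU heU, heη, fun h ↦ (Finset.disjoint_left.1 hζ₀U h) heU⟩
      · exact ⟨heE, fun h ↦ heU (hη h), heζ⟩
  have hdisj : Disjoint (U \ η) ((G.edgeFinset \ U) \ ζ₀) :=
    Finset.disjoint_of_subset_left sdiff_subset
      (Finset.disjoint_of_subset_right sdiff_subset disjoint_sdiff)
  have hcard₂ : #(G.edgeFinset \ (η ∪ ζ₀)) = #(U \ η) + (#(G.edgeFinset \ U) - #ζ₀) := by
    rw [hsplit, card_union_of_disjoint hdisj, card_sdiff_of_subset hζ₀]
  -- cluster counts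
  have hk : clusterCount (↑(η ∪ ζ₀) : BondConfig V) B + clusterCount (∅ : BondConfig V) (B \ S) =
      clusterCount (↑ζ₀ : BondConfig V) B + clusterCount (↑η : BondConfig V) (B \ S) := by
    rw [Finset.coe_union]
    exact clusterCount_union_add_eq_of_closed_cut η (↑ζ₀) (fun e he ↦ hUS e (hη he))
      (fun e he x hx ↦ hζS e (Finset.mem_coe.1 he) x hx)
  have hq : q ^ clusterCount (↑(η ∪ ζ₀) : BondConfig V) B *
      q ^ clusterCount (∅ : BondConfig V) (B \ S) =
      q ^ clusterCount (↑ζ₀ : BondConfig V) B * q ^ clusterCount (↑η : BondConfig V) (B \ S) := by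
    rw [← pow_add, ← pow_add, hk]
  simp only [rcWeight, hEU, hcard₁, hcard₂, pow_add]
  calc p ^ #η * p ^ #ζ₀ * ((1 - p) ^ #(U \ η) * (1 - p) ^ (#(G.edgeFinset \ U) - #ζ₀)) *
        q ^ clusterCount (↑(η ∪ ζ₀) : BondConfig V) B *
        q ^ clusterCount (∅ : BondConfig V) (B \ S)
      = p ^ #η * p ^ #ζ₀ * ((1 - p) ^ #(U \ η) * (1 - p) ^ (#(G.edgeFinset \ U) - #ζ₀)) *
        (q ^ clusterCount (↑(η ∪ ζ₀) : BondConfig V) B *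
        q ^ clusterCount (∅ : BondConfig V) (B \ S)) := by ring
    _ = p ^ #η * p ^ #ζ₀ * ((1 - p) ^ #(U \ η) * (1 - p) ^ (#(G.edgeFinset \ U) - #ζ₀)) *
        (q ^ clusterCount (↑ζ₀ : BondConfig V) B *
        q ^ clusterCount (↑η : BondConfig V) (B \ S)) := by rw [hq]
    _ = _ := by ring

/-- **Domain Markov property across a closed cut, exact form on a cylinder** (Grimmett 2006,
Thm. (3.1)(a), eq. (3.2), and Lemma (4.13)). Let `U ⊆ E(G)` be a region none of whose edges has an
endpoint in `S`, and `ζ₀ ⊆ E(G) ∖ U` a configuration off the region all of whose edges lie inside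
`S`. Then for EVERY event `A` and every wired set `B`,
`φ^B_{G,p,q}({ω ∩ U ∈ A} ∩ {ω ∖ U = ζ₀}) = φ^B_{G,p,q}({ω ∖ U = ζ₀}) · φ^{B ∖ S}_{⟨U⟩,p,q}(A)`
(`0 ≤ p ≤ 1`, `q > 0`). [cite: Grimmett2006, Thm. (3.1)(a) and Lemma (4.13)] -/
theorem rcMeasure_real_inter_cylinder_eq_mul_fromEdgeSet_of_closed_cut {p q : ℝ}
    (hp : p ∈ Set.Icc (0 : ℝ) 1) (hq : 0 < q) (B S : Set V) (U : Finset (Sym2 V))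
    (hU : U ⊆ G.edgeFinset) {ζ₀ : Finset (Sym2 V)} (hζ₀ : ζ₀ ⊆ G.edgeFinset \ U)
    (hUS : ∀ e ∈ U, ∀ x ∈ e, x ∉ S) (hζS : ∀ e ∈ ζ₀, ∀ x ∈ e, x ∈ S)
    (A : Set (BondConfig V)) :
    (rcMeasure G p q B).real ({ω | ω ∩ ↑U ∈ A} ∩ {ω | ω ∩ (↑U : Set (Sym2 V))ᶜ = ↑ζ₀}) =
      (rcMeasure G p q B).real {ω | ω ∩ (↑U : Set (Sym2 V))ᶜ = ↑ζ₀} *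
        (rcMeasure (fromEdgeSet (U : Set (Sym2 V))) p q (B \ S)).real A := by
  classical
  have hZ := rcPartitionFunction_pos G hp hq B
  set GU : SimpleGraph V := fromEdgeSet (U : Set (Sym2 V)) with hGU
  have hEU : ∀ i : Fintype GU.edgeSet, @SimpleGraph.edgeFinset V GU i = U := fun i ↦
    @edgeFinset_fromEdgeSet_of_subset V _ G _ U hU i
  haveI : IsProbabilityMeasure (rcMeasure GU p q (B \ S)) :=
    isProbabilityMeasure_rcMeasure GU hp hq (B \ S)
  have hqW : 0 < q ^ clusterCount (∅ : BondConfig V) (B \ S) := pow_pos hq _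
  set c : ℝ := p ^ #ζ₀ * (1 - p) ^ (#(G.edgeFinset \ U) - #ζ₀) *
    q ^ clusterCount (↑ζ₀ : BondConfig V) B / q ^ clusterCount (∅ : BondConfig V) (B \ S) with hc
  have hweight : ∀ η : Finset (Sym2 V), η ⊆ U →
      rcWeight G p q B (η ∪ ζ₀) = c * rcWeight GU p q (B \ S) η := by
    intro η hη
    have h := rcWeight_union_mul_eq_mul_rcWeight_fromEdgeSet_of_closed_cut G p q hU hζ₀ hη hUS hζS
      (B := B)
    rw [hc]
    field_simp
    linarith [h]
  -- `Z_G φ_G({ω ∩ U ∈ A'} ∩ {ω ∖ U = ζ₀}) = c · Z^{B∖S}_U φ^{B∖S}_U(A')`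
  have key : ∀ A' : Set (BondConfig V), rcPartitionFunction G p q B *
      (rcMeasure G p q B).real ({ω | ω ∩ ↑U ∈ A'} ∩ {ω | ω ∩ (↑U : Set (Sym2 V))ᶜ = ↑ζ₀}) =
      c * (rcPartitionFunction GU p q (B \ S) * (rcMeasure GU p q (B \ S)).real A') := by
    intro A'
    rw [rcPartitionFunction_mul_real_inter_cylinder G hp hq B hU hζ₀ A']
    have h2 : rcPartitionFunction GU p q (B \ S) * (rcMeasure GU p q (B \ S)).real A' =
        ∑ η ∈ U.powerset, rcWeight GU p q (B \ S) η *
          (if (↑η : BondConfig V) ∈ A' then 1 else 0) := by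
      rw [rcMeasure_real_apply GU hp hq (B \ S) A', Finset.mul_sum, hEU]
      refine Finset.sum_congr rfl fun η _ ↦ ?_
      have hZU := (rcPartitionFunction_pos GU hp hq (B \ S)).ne'
      split_ifs
      · field_simp
      · simp
    rw [h2, Finset.mul_sum]
    refine Finset.sum_congr rfl fun η hη ↦ ?_
    rw [hweight η (Finset.mem_powerset.1 hη)]
    ring
  have k1 := key A
  have k2 := key Set.univ
  simp only [Set.mem_univ, Set.setOf_true, Set.univ_inter, probReal_univ, mul_one] at k2
  apply mul_left_cancel₀ hZ.ne'
  rw [k1, ← mul_assoc (rcPartitionFunction G p q B), k2]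
  ring

/-! ### Summing over an event on which the cut is closed -/

/-- **Domain Markov property across a closed cut, summed over an outside event** (Grimmett 2006,
Thm. (3.1)(a) and Lemma (4.13)). Let `U ⊆ E(G)` be a region none of whose edges has an endpoint in
`S`, and `F` an event determined by the configuration off `U` such that every configuration
`ζ ⊆ E(G) ∖ U` with `↑ζ ∈ F` has all its edges inside `S`. Then for every event `A` and every wired
set `B`, `φ^B_G({ω ∩ U ∈ A} ∩ F) = φ^B_G(F) · φ^{B ∖ S}_{⟨U⟩}(A)` (`0 ≤ p ≤ 1`, `q > 0`).
[cite: Grimmett2006, Thm. (3.1)(a) and Lemma (4.13)] -/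
theorem rcMeasure_real_inter_eq_mul_fromEdgeSet_of_closed_cut {p q : ℝ}
    (hp : p ∈ Set.Icc (0 : ℝ) 1) (hq : 0 < q) (B S : Set V) (U : Finset (Sym2 V))
    (hU : U ⊆ G.edgeFinset) (hUS : ∀ e ∈ U, ∀ x ∈ e, x ∉ S)
    (F : Set (BondConfig V))
    (hF : ∀ ω₁ ω₂ : BondConfig V, ω₁ ∩ (↑U)ᶜ = ω₂ ∩ (↑U)ᶜ → (ω₁ ∈ F ↔ ω₂ ∈ F))
    (hFS : ∀ ζ : Finset (Sym2 V), ζ ⊆ G.edgeFinset \ U → (↑ζ : BondConfig V) ∈ F →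
      ∀ e ∈ ζ, ∀ x ∈ e, x ∈ S)
    (A : Set (BondConfig V)) :
    (rcMeasure G p q B).real ({ω | ω ∩ ↑U ∈ A} ∩ F) =
      (rcMeasure G p q B).real F * (rcMeasure (fromEdgeSet (U : Set (Sym2 V))) p q (B \ S)).real A := by
  classical
  -- decompose both sides along the cylinders of `U`
  have hF' : (rcMeasure G p q B).real F = (rcMeasure G p q B).real (Set.univ ∩ F) := by
    rw [Set.univ_inter]
  rw [rcMeasure_real_inter_eq_sum_cylinder G hp hq B U {ω | ω ∩ ↑U ∈ A} F hF, hF',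
    rcMeasure_real_inter_eq_sum_cylinder G hp hq B U Set.univ F hF, Finset.sum_mul]
  refine Finset.sum_congr rfl fun ζ hζ ↦ ?_
  rw [Finset.mem_filter, Finset.mem_powerset] at hζ
  rw [Set.univ_inter]
  exact rcMeasure_real_inter_cylinder_eq_mul_fromEdgeSet_of_closed_cut G hp hq B S U hU hζ.1 hUS
    (hFS ζ hζ.1 hζ.2) A

end Finite

/-! ### The closed-cut Markov property at a vertex set -/

/-- **Domain Markov property of the random-cluster measure across a closed vertex cut**
(Grimmett 2006, Thm. (3.1)(a) and Lemma (4.13); Duminil-Copin–Smirnov 2012, §3.2). Let `G` be a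
finite graph, `B` ANY wired set, `S` a vertex set, `T` the set of edges of `G` touching `S`, `F` an
event determined by the configuration on `T` on which every OPEN edge of `T` has both endpoints in
`S` (no open edge crosses the cut between `S` and `Sᶜ`), and `C` an event determined by the
configuration on the remaining edges `E(G) ∖ T`. Then
`φ^B_{G,p,q}(F ∩ C) = φ^B_{G,p,q}(F) · φ^{B ∖ S}_{⟨E(G) ∖ T⟩,p,q}(C)` (`0 ≤ p ≤ 1`, `q > 0`):
conditionally on `F`, the configuration off `T` is the random-cluster configuration of the spanning
graph `⟨E(G) ∖ T⟩` with wired set `B ∖ S`, whatever `B` is on the `S` side.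
[cite: Grimmett2006, Thm. (3.1)(a) and Lemma (4.13)] -/
theorem rcMeasure_real_inter_eq_mul_of_closed_cut :
    ∀ {V : Type*} [Fintype V] [DecidableEq V] (G : SimpleGraph V) [DecidableRel G.Adj] {p q : ℝ}, p ∈ Set.Icc (0 : ℝ) 1 → 0 < q → ∀ (B S : Set V) (T : Finset (Sym2 V)), (∀ e, e ∈ T ↔ e ∈ G.edgeFinset ∧ ∃ v ∈ S, v ∈ e) → ∀ (F : Set (Literature.Probability.Percolation.BondConfig V)), (∀ ω₁ ω₂ : Literature.Probability.Percolation.BondConfig V, ω₁ ∩ ↑T = ω₂ ∩ ↑T → (ω₁ ∈ F ↔ ω₂ ∈ F)) → (∀ ω ∈ F, ∀ e ∈ ω, e ∈ T → ∀ x ∈ e, x ∈ S) → ∀ (C : Set (Literature.Probability.Percolation.BondConfig V)), (∀ ω₁ ω₂ : Literature.Probability.Percolation.BondConfig V, ω₁ ∩ (↑(G.edgeFinset \ T)) = ω₂ ∩ (↑(G.edgeFinset \ T)) → (ω₁ ∈ C ↔ ω₂ ∈ C)) → (Literature.Probability.LatticeModels.rcMeasure G p q B).real (F ∩ C) = (Literature.Probability.LatticeModels.rcMeasure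 G p q B).real F * (Literature.Probability.LatticeModels.rcMeasure (SimpleGraph.fromEdgeSet (↑(G.edgeFinset \ T) : Set (Sym2 V))) p q (B \ S)).real C := by
  intro V _ _ G _ p q hp hq B S T hT F hF hFS C hC
  classical
  set U : Finset (Sym2 V) := G.edgeFinset \ T with hUdef
  have hU : U ⊆ G.edgeFinset := sdiff_subset
  have hTE : T ⊆ G.edgeFinset := fun e he ↦ ((hT e).1 he).1
  -- the edges off `T` have no endpoint in `S`
  have hUS : ∀ e ∈ U, ∀ x ∈ e, x ∉ S := by
    intro e he x hx hxS
    have he' := Finset.mem_sdiff.1 he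
    exact he'.2 ((hT e).2 ⟨he'.1, x, hxS, hx⟩)
  -- `F` is determined by the configuration off `U` (as `T` is disjoint from `U`)
  have hTU : Disjoint T U := disjoint_sdiff
  have hF' : ∀ ω₁ ω₂ : BondConfig V, ω₁ ∩ (↑U)ᶜ = ω₂ ∩ (↑U)ᶜ → (ω₁ ∈ F ↔ ω₂ ∈ F) :=
    determined_off_of_determined_on_disjoint hTU hF
  -- on `F` the configurations off `U` lie inside `S`
  have hFS' : ∀ ζ : Finset (Sym2 V), ζ ⊆ G.edgeFinset \ U → (↑ζ : BondConfig V) ∈ F →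
      ∀ e ∈ ζ, ∀ x ∈ e, x ∈ S := by
    intro ζ hζ hζF e he x hx
    have he' := Finset.mem_sdiff.1 (hζ he)
    have heT : e ∈ T := by
      by_contra heT
      exact he'.2 (Finset.mem_sdiff.2 ⟨he'.1, heT⟩)
    exact hFS _ hζF e (Finset.mem_coe.2 he) heT x hx
  -- `C` is the event "the configuration on `U` lies in `C`"
  have hCeq : F ∩ C = {ω : BondConfig V | ω ∩ ↑U ∈ C} ∩ F := by
    ext ω
    simp only [Set.mem_inter_iff, Set.mem_setOf_eq]
    have h : ω ∈ C ↔ ω ∩ ↑U ∈ C := hC ω (ω ∩ ↑U) (by rw [Set.inter_assoc, Set.inter_self])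
    rw [h, and_comm]
  rw [hCeq]
  exact rcMeasure_real_inter_eq_mul_fromEdgeSet_of_closed_cut G hp hq B S U hU hUS F hF' hFS' C

end Literature.Probability.LatticeModels

end
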